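import Mathlib
import HarnessLib
import Literature.NumberTheory.GaloisRepresentations.NearlyOrdinaryDeformationRingProofs

/-! # Generic `GL₂` algebra for the oriented datum: helper file `…OrientedSteinbergDatumAlgebraAux` for stub
`stub_orientedSteinbergDatum` of line steinberg-hyperplane (crux ReducibleOrdinaryProModular, stmt-Langlands-12919)

* `exists_hom_of_forall_mem_range`: descent of `Γ → GL_n(B)` along an injective `A → B` when all entries come from `A`;
* `exists_frameGL`: the oriented frame `(x 1; 1 0) ∈ GL₂(A)` and the entries of `P⁻¹ M P`;
* `hasScalarCentralizer_of_nonsplit` (REGISTERED as `stub_orientedSteinbergDatum_auxScalarCentralizer`): a non-split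
  upper-triangular family with distinct diagonal characters has scalar centralizer (Berger–Klosin, Math. Ann. 355
  (2013), Lemma 28, in matrix form; Mazur's representability hypothesis for `ρ̄ = (χ̄_a ∗; 0 χ̄_b)`);
* `isOpen_ker_map_comp`: open kernels of reductions of a `GL₂(A)`-valued homomorphism whose entries, read in `ℚ̄_p`,
  are continuous.
-/

set_option linter.dupNamespace false
set_option autoImplicit false

namespace Summit.Langlands.Langlands.Cruxes.ReducibleOrdinaryProModular.SteinbergHyperplane

open scoped MatrixGroups
open Matrix
open Literature.NumberTheory.GaloisRepresentations

noncomputable section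

namespace OrientedDatum

variable {p : ℕ} [Fact p.Prime]

/-! ### Generic algebra -/

/-- **Descent of a matrix-valued homomorphism along an injective ring map**: if all entries of all `φ g` lie
in the image of `f : A → B`, then `φ = GL₂(f) ∘ φ₀` for a homomorphism `φ₀ : Γ → GL_n(A)`. [folklore] -/
theorem exists_hom_of_forall_mem_range {Γ : Type*} [Group Γ] {A B : Type*} [CommRing A] [CommRing B]
    (f : A →+* B) (hf : Function.Injective f) {n : ℕ} (φ : Γ →* GL (Fin n) B)
    (h : ∀ g i j, (φ g).val i j ∈ f.range) :
    ∃ φ₀ : Γ →* GL (Fin n) A, ∀ g, Matrix.GeneralLinearGroup.map f (φ₀ g) = φ g := by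
  classical
  have hinj := Deformation.generalLinearGroup_map_injective (n := Fin n) f hf
  have hmapinj : Function.Injective fun M : Matrix (Fin n) (Fin n) A => M.map f :=
    fun M N hMN => Matrix.ext fun i j => hf (congrFun (congrFun hMN i) j)
  have hmem : ∀ g, φ g ∈ (Matrix.GeneralLinearGroup.map (n := Fin n) f).range := by
    intro g
    let X : Γ → Matrix (Fin n) (Fin n) A := fun g => Matrix.of fun i j => (h g i j).choose
    have hX : ∀ g, (X g).map f = (φ g).val := fun g => Matrix.ext fun i j => (h g i j).choose_spec
    have h1 : (1 : Matrix (Fin n) (Fin n) A).map f = 1 := Matrix.map_one f (map_zero f) (map_one f)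
    have hXX : X g * X g⁻¹ = 1 := hmapinj (by
      change (X g * X g⁻¹).map f = (1 : Matrix (Fin n) (Fin n) A).map f
      rw [Matrix.map_mul, hX, hX, h1, ← Units.val_mul, map_inv, mul_inv_cancel, Units.val_one])
    have hXX' : X g⁻¹ * X g = 1 := hmapinj (by
      change (X g⁻¹ * X g).map f = (1 : Matrix (Fin n) (Fin n) A).map f
      rw [Matrix.map_mul, hX, hX, h1, ← Units.val_mul, map_inv, inv_mul_cancel, Units.val_one])
    exact ⟨⟨X g, X g⁻¹, hXX, hXX'⟩, Units.ext (hX g)⟩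
  let e : GL (Fin n) A ≃* (Matrix.GeneralLinearGroup.map (n := Fin n) f).range := MonoidHom.ofInjective hinj
  refine ⟨e.symm.toMonoidHom.comp (φ.codRestrict _ hmem), fun g => ?_⟩
  have h1 : (Matrix.GeneralLinearGroup.map f (e.symm (φ.codRestrict _ hmem g)) : GL (Fin n) B) =
      ((e (e.symm (φ.codRestrict _ hmem g)) : (Matrix.GeneralLinearGroup.map (n := Fin n) f).range) :
        GL (Fin n) B) := rfl
  rw [MonoidHom.comp_apply, MulEquiv.coe_toMonoidHom, h1, MulEquiv.apply_symm_apply]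
  rfl

/-- **The oriented frame `P = (x 1; 1 0)`** as an element of `GL₂(A)`, with
`P⁻¹ M P = (c x + d, c; a x + b - x (c x + d), a - x c)` for `M = (a b; c d)`. [folklore] -/
theorem exists_frameGL {A : Type*} [CommRing A] (x : A) :
    ∃ P : GL (Fin 2) A, P.val = !![x, 1; 1, 0] ∧
      ∀ M : Matrix (Fin 2) (Fin 2) A,
        ((P⁻¹).val * M * P.val) 0 0 = M 1 0 * x + M 1 1 ∧ ((P⁻¹).val * M * P.val) 0 1 = M 1 0 ∧
        ((P⁻¹).val * M * P.val) 1 0 = M 0 0 * x + M 0 1 - x * (M 1 0 * x + M 1 1) ∧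
        ((P⁻¹).val * M * P.val) 1 1 = M 0 0 - x * M 1 0 := by
  have h1 : !![x, 1; 1, 0] * !![0, 1; 1, -x] = (1 : Matrix (Fin 2) (Fin 2) A) := by
    rw [Matrix.mul_fin_two, Matrix.one_fin_two]; simp
  have h2 : !![0, 1; 1, -x] * !![x, 1; 1, 0] = (1 : Matrix (Fin 2) (Fin 2) A) := by
    rw [Matrix.mul_fin_two, Matrix.one_fin_two]; simp
  refine ⟨⟨_, _, h1, h2⟩, rfl, fun M => ?_⟩
  have hc : !![0, 1; 1, -x] * M * !![x, 1; 1, 0] =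
      !![M 1 0 * x + M 1 1, M 1 0; M 0 0 * x + M 0 1 - x * (M 1 0 * x + M 1 1), M 0 0 - x * M 1 0] := by
    rw [Matrix.eta_fin_two M, Matrix.mul_fin_two, Matrix.mul_fin_two]
    ext i j
    fin_cases i <;> fin_cases j <;> simp <;> ring
  change (!![0, 1; 1, -x] * M * !![x, 1; 1, 0]) 0 0 = _ ∧ (!![0, 1; 1, -x] * M * !![x, 1; 1, 0]) 0 1 = _ ∧
    (!![0, 1; 1, -x] * M * !![x, 1; 1, 0]) 1 0 = _ ∧ (!![0, 1; 1, -x] * M * !![x, 1; 1, 0]) 1 1 = _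
  rw [hc]
  exact ⟨rfl, rfl, rfl, rfl⟩

/-- **Scalar centralizer of a non-split extension of distinct characters** (Berger–Klosin Lemma 28 in matrix
form): if `r̄(g) = (α β; 0 δ)` with `α(g₀) ≠ δ(g₀)` for some `g₀` and NO `x` with `β = x (δ - α)` identically
(non-split), every matrix commuting with all `r̄(g)` is scalar. [cite: BergerKlosin2012, §5.2] -/
theorem hasScalarCentralizer_of_nonsplit {κ : Type*} [Field κ] {Γ : Type*} (r : Γ → Matrix (Fin 2) (Fin 2) κ)
    (h10 : ∀ g, r g 1 0 = 0) (hdist : ∃ g, r g 0 0 ≠ r g 1 1)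
    (hns : ∀ x : κ, ∃ g, r g 0 1 ≠ x * (r g 1 1 - r g 0 0))
    (M : Matrix (Fin 2) (Fin 2) κ) (hM : ∀ g, M * r g = r g * M) : ∃ c : κ, M = c • (1 : Matrix (Fin 2) (Fin 2) κ) := by
  obtain ⟨g₀, hg₀⟩ := hdist
  have e10 : ∀ g, M 1 0 * r g 0 0 = r g 1 1 * M 1 0 := fun g => by
    have := congrFun (congrFun (hM g) 1) 0
    simp only [Matrix.mul_apply, Fin.sum_univ_two, h10 g, mul_zero, add_zero, zero_mul, zero_add] at this
    exact this
  have hM10 : M 1 0 = 0 := by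
    have h := e10 g₀
    have : M 1 0 * (r g₀ 0 0 - r g₀ 1 1) = 0 := by rw [mul_sub, h]; ring
    rcases mul_eq_zero.1 this with h0 | h0
    · exact h0
    · exact absurd (sub_eq_zero.1 h0) hg₀
  have e01 : ∀ g, r g 0 1 * (M 0 0 - M 1 1) = M 0 1 * (r g 0 0 - r g 1 1) := fun g => by
    have := congrFun (congrFun (hM g) 0) 1
    simp only [Matrix.mul_apply, Fin.sum_univ_two] at this
    linear_combination this
  have hM0011 : M 0 0 = M 1 1 := by
    by_contra hne
    have hne' : M 0 0 - M 1 1 ≠ 0 := sub_ne_zero.2 hne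
    obtain ⟨g, hg⟩ := hns (-(M 0 1 / (M 0 0 - M 1 1)))
    apply hg
    have := e01 g
    field_simp
    linear_combination this
  have hM01 : M 0 1 = 0 := by
    have h := e01 g₀
    rw [hM0011, sub_self, mul_zero] at h
    rcases mul_eq_zero.1 h.symm with h0 | h0
    · exact h0
    · exact absurd (sub_eq_zero.1 h0) hg₀
  refine ⟨M 0 0, ?_⟩
  ext i j
  fin_cases i <;> fin_cases j <;> simp [hM10, hM01, hM0011]

/-- **Open kernels from the norm topology.**  Let `ρ_A : Γ → GL₂(A)` map entrywise, along `e : A → ℚ̄_p`, to a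
family `ρ'` whose entries are continuous in `g`, and let `q : A → A'` be a ring map whose kernel is `e⁻¹(U)` for
an open `U ⊆ ℚ̄_p`.  Then `ker (GL₂(q) ∘ ρ_A)` is open in `Γ`. [folklore] -/
theorem isOpen_ker_map_comp {Γ : Type*} [Group Γ] [TopologicalSpace Γ] {A A' : Type*} [CommRing A]
    [CommRing A'] (e : A →+* PadicAlgCl p) (q : A →+* A') (U : Set (PadicAlgCl p)) (hU : IsOpen U)
    (hqU : ∀ y : A, q y = 0 ↔ e y ∈ U) (ρA : Γ →* GL (Fin 2) A)
    (ρ' : Γ → Matrix (Fin 2) (Fin 2) (PadicAlgCl p)) (hcont : ∀ i j, Continuous fun g => ρ' g i j)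
    (he : ∀ g i j, e ((ρA g).val i j) = ρ' g i j) :
    IsOpen (((Matrix.GeneralLinearGroup.map q).comp ρA).ker : Set Γ) := by
  have hone : ∀ i j : Fin 2, e ((1 : Matrix (Fin 2) (Fin 2) A) i j) = (1 : Matrix (Fin 2) (Fin 2) (PadicAlgCl p)) i j := by
    intro i j
    by_cases hij : i = j
    · subst hij; simp
    · simp [Matrix.one_apply_ne hij]
  have hone' : ∀ i j : Fin 2, q ((1 : Matrix (Fin 2) (Fin 2) A) i j) = (1 : Matrix (Fin 2) (Fin 2) A') i j := by
    intro i j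
    by_cases hij : i = j
    · subst hij; simp
    · simp [Matrix.one_apply_ne hij]
  have hker : (((Matrix.GeneralLinearGroup.map q).comp ρA).ker : Set Γ) =
      ⋂ i, ⋂ j, (fun g => ρ' g i j - (1 : Matrix (Fin 2) (Fin 2) (PadicAlgCl p)) i j) ⁻¹' U := by
    ext g
    simp only [SetLike.mem_coe, MonoidHom.mem_ker, MonoidHom.comp_apply, Set.mem_iInter, Set.mem_preimage]
    constructor
    · intro hg i j
      have hij := congrArg (fun M : GL (Fin 2) A' => M.val i j) hg
      simp only [Matrix.GeneralLinearGroup.map_apply, Units.val_one] at hij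
      rw [← he, ← hone, ← map_sub, ← hqU, map_sub, hij, hone', sub_self]
    · intro hg
      refine Units.ext (Matrix.ext fun i j => ?_)
      have hij := hg i j
      rw [← he, ← hone, ← map_sub, ← hqU, map_sub, sub_eq_zero, hone'] at hij
      rw [Matrix.GeneralLinearGroup.map_apply, Units.val_one]
      exact hij
  rw [hker]
  refine isOpen_iInter_of_finite fun i => isOpen_iInter_of_finite fun j => ?_
  exact hU.preimage ((hcont i j).sub continuous_const)

end OrientedDatum

/-- **Registered sub-goal of `stub_orientedSteinbergDatum` (auxiliary algebra file): scalar centralizer of a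
non-split extension of distinct characters** (= `OrientedDatum.hasScalarCentralizer_of_nonsplit` with explicit
binders). [cite: BergerKlosin2012, §5.2] -/
theorem stub_orientedSteinbergDatum_auxScalarCentralizer :
    ∀ (κ : Type) [Field κ] (Γ : Type) (r : Γ → Matrix (Fin 2) (Fin 2) κ), (∀ g, r g 1 0 = 0) → (∃ g, r g 0 0 ≠ r g 1 1) → (∀ x : κ, ∃ g, r g 0 1 ≠ x * (r g 1 1 - r g 0 0)) → ∀ M : Matrix (Fin 2) (Fin 2) κ, (∀ g, M * r g = r g * M) → ∃ c : κ, M = c • (1 : Matrix (Fin 2) (Fin 2) κ) :=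
  fun _ _ _ r h10 hdist hns M hM => OrientedDatum.hasScalarCentralizer_of_nonsplit r h10 hdist hns M hM

end

end Summit.Langlands.Langlands.Cruxes.ReducibleOrdinaryProModular.SteinbergHyperplane
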